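import Summits.CriticalPhenomena.CardyFormulaZ2.Theorems.CardyComplexConeEdgePrecompactUFRSStrandsArmsCrossing
import Summits.CriticalPhenomena.CardyFormulaZ2.Theorems.CardyComplexConeEdgePrecompactUFRSMerge
import Literature.Probability.LatticeModels.CornerPermutation

/-!
# The piece table across two completions: corner-disjoint strands of different configurations
(line `qkz-strip-boundary-arm` of crux `CardyComplexCone.EdgePrecompact`, stmt-CriticalPhenomena-11387;
first input of the registered open sub-goal `ufrs_rect_threeStrands_dichotomy` — the
dichotomy-extraction lemma behind the flat three-strand decay HT for MIXED tags; worker W-HT of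
lead c5, wave 4)

The sector argument of `strands_sectorsZ` (`…UFRSStrandsHpArmsPureSectors.lean`) treats `k`
corner-disjoint orbit stretches of ONE completed configuration `β`: its planar inputs are the
piece table `pieces_meet` (two pieces of the perturbed polylines meet only at a common corner),
`openEdge_not_mem_piece` (open edges miss the pieces) and `crossSeg_not_mem_piece` (closed dual
steps miss the pieces). For the three strands of `ufrsStrands E w z 3 s S` the configurations are
`E.bcBondConfig ω` and `(shiftData E w).bcBondConfig ω`, which DIFFER inside the strip between the
two boundary rows. This file extends the table to two configurations `β₁, β₂`:

* `conn_conn_two_HT4` — two connectors (drawn with `nextCorner β₁`, resp. `nextCorner β₂`) meet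
  only if they are connectors of the same corner or lead into the same corner: the only new case
  is the vertex connector across an edge closed in one configuration against the face connector
  along the same edge, open in the other, from the opposite in-corner; both end at the source
  point of the common successor (`nextCorner_opp_of_mem_HT4`);
* `ufrs_piecesMeet_two` (registered anchor) — **pieces of two orbit stretches of two
  configurations meet only at a common corner** (so corner-disjoint strands of different
  completions still have disjoint perturbed polylines);
* `conn_meets_edge_HT4` — a connector meets a lattice edge only if it is the vertex turn across
  that edge (closed for its configuration) (read off `cyConn_cases`);
* `followedEdge_meets_piece_HT4` — if a piece of a `β₂`-orbit meets the target edge of a corner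
  `p` followed by `β₁` (`cTgt p ∈ β₁`), then the orbit passes through `p` or through
  `nextCorner β₁ p`;
* `crossSeg_meets_piece_HT4` — the same for the crossing segment of a corner `p` with
  `cTgt p ∉ β₁`.

These are the per-step forms of the obstacle hypotheses `hKe`, `hKx` of `chain_in_component`
needed to run the sector argument with one configuration per strand.

References: S. Smirnov, C. R. Acad. Sci. Paris 333 (2001), §2 (the medial exploration and its
perturbed drawing); M. Aizenman, A. Burchard, Duke Math. J. 99 (1999), App. A (sectors).
-/

namespace Summit.CriticalPhenomena.CardyFormulaZ2.Cruxes.EdgePrecompact.QkzStripBoundaryArm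

open MeasureTheory Filter Set Metric Complex
open scoped Topology BigOperators Pointwise
open Literature.Probability.LatticeModels Literature.Probability.Percolation
open Literature.Probability.RandomPlanarGeometry (DobrushinDomain)
open Summit.CriticalPhenomena.CardyFormulaZ2.Theses.CardyComplexCone

noncomputable section

/-! ## The opposite in-corner -/

/-- **Crossing from one side, bouncing from the other, lead into the same corner.** If the target
edge of `p` is closed in `β₁` (vertex turn of `p`) and open in `β₂` for the opposite in-corner
`p̄ = (v + u_{k+1}, k+2)` (face turn of `p̄`), then `nextCorner β₂ p̄ = nextCorner β₁ p`. -/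
theorem nextCorner_opp_of_mem_HT4 {β₁ β₂ : BondConfig (Site 2)} {p : Site 2 × Fin 4}
    (h₁ : cTgt p ∉ β₁) (h₂ : cTgt ((p.1 + cornerUnit (p.2 + 1), p.2 + 2) : Site 2 × Fin 4) ∈ β₂) :
    nextCorner β₂ ((p.1 + cornerUnit (p.2 + 1), p.2 + 2) : Site 2 × Fin 4) = nextCorner β₁ p := by
  rw [nextCorner_of_mem h₂, nextCorner_of_not_mem h₁]
  refine Prod.ext ?_ (fin4_add_two_add_three _)
  show p.1 + cornerUnit (p.2 + 1) + cornerUnit (p.2 + 2 + 1) = p.1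
  rw [fin4_add_two_add_one, show p.2 + 3 = p.2 + 1 + 2 from (fin4_add_one_add_two p.2).symm, cornerUnit_add_two]
  abel

/-- **Bouncing from one side, crossing from the other, lead into the same corner.** If the
target edge of `p` is open in `β₁` (face turn of `p`) and closed in `β₂` for the opposite
in-corner `p̄` (vertex turn of `p̄`), then `nextCorner β₂ p̄ = nextCorner β₁ p`. -/
theorem nextCorner_opp_of_not_mem_HT4 {β₁ β₂ : BondConfig (Site 2)} {p : Site 2 × Fin 4}
    (h₁ : cTgt p ∈ β₁) (h₂ : cTgt ((p.1 + cornerUnit (p.2 + 1), p.2 + 2) : Site 2 × Fin 4) ∉ β₂) :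
    nextCorner β₂ ((p.1 + cornerUnit (p.2 + 1), p.2 + 2) : Site 2 × Fin 4) = nextCorner β₁ p := by
  rw [nextCorner_of_not_mem h₂, nextCorner_of_mem h₁]
  exact Prod.ext rfl (fin4_add_two_add_one _)

/-! ## Two connectors of two configurations -/

/-- **Two connectors of two configurations meet only if they are connectors of the same corner
or lead into the same corner.** -/
theorem conn_conn_two_HT4 {β₁ β₂ : BondConfig (Site 2)} {p p' : Site 2 × Fin 4} {z : ℂ}
    (hz : z ∈ segment ℝ (tPt p) (sPt (nextCorner β₁ p))) (hz' : z ∈ segment ℝ (tPt p') (sPt (nextCorner β₂ p'))) :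
    p' = p ∨ nextCorner β₂ p' = nextCorner β₁ p := by
  by_cases hc : cTgt p ∈ β₁ <;> by_cases hc' : cTgt p' ∈ β₂
  · rw [nextCorner_of_mem hc] at hz; rw [nextCorner_of_mem hc'] at hz'
    exact Or.inl (eq_of_mem_fconn_fconn hz hz')
  · rw [nextCorner_of_mem hc] at hz; rw [nextCorner_of_not_mem hc'] at hz'
    rcases eq_of_mem_vconn_fconn hz' hz with h | h
    · exact Or.inl h.symm
    · right
      subst h
      exact (nextCorner_opp_of_mem_HT4 hc' hc).symm
  · rw [nextCorner_of_not_mem hc] at hz; rw [nextCorner_of_mem hc'] at hz'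
    rcases eq_of_mem_vconn_fconn hz hz' with h | h
    · exact Or.inl h
    · right
      subst h
      exact nextCorner_opp_of_mem_HT4 hc hc'
  · rw [nextCorner_of_not_mem hc] at hz; rw [nextCorner_of_not_mem hc'] at hz'
    exact Or.inl (eq_of_mem_vconn_vconn hz hz')

/-- **Two pieces of two orbit stretches of two configurations meet only at a common corner**: if
the piece `j` of the orbit of `q₁` under `β₁` meets the piece `j'` of the orbit of `q₂` under
`β₂`, then a corner `O₁ q₁ s`, `s ∈ {j/2, (j+1)/2}`, equals a corner `O₂ q₂ t`,
`t ∈ {j'/2, (j'+1)/2}`. -/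
theorem pieces_meet_two_HT4 {β₁ β₂ : BondConfig (Site 2)} (q₁ q₂ : Site 2 × Fin 4) {j j' : ℕ} {z : ℂ}
    (hz : z ∈ segment ℝ (pieceVert β₁ q₁ j) (pieceVert β₁ q₁ (j + 1)))
    (hz' : z ∈ segment ℝ (pieceVert β₂ q₂ j') (pieceVert β₂ q₂ (j' + 1))) :
    ∃ s t, (s = j / 2 ∨ s = (j + 1) / 2) ∧ (t = j' / 2 ∨ t = (j' + 1) / 2) ∧
      cornerOrbit β₁ q₁ s = cornerOrbit β₂ q₂ t := by
  obtain ⟨m, rfl | rfl⟩ := Nat.even_or_odd' j <;> obtain ⟨m', rfl | rfl⟩ := Nat.even_or_odd' j'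
  · rw [pieceVert_even, pieceVert_odd] at hz hz'
    exact ⟨m, m', Or.inl (by omega), Or.inl (by omega), (eq_of_mem_dart_dart hz hz').symm⟩
  · rw [pieceVert_even, pieceVert_odd] at hz
    rw [pieceVert_odd, show 2 * m' + 1 + 1 = 2 * m' + 2 by ring, pieceVert_odd_succ] at hz'
    rcases eq_or_next_eq_of_mem_dart_conn hz hz' with h | h
    · exact ⟨m, m', Or.inl (by omega), Or.inl (by omega), h.symm⟩
    · exact ⟨m, m' + 1, Or.inl (by omega), Or.inr (by omega), h.symm⟩
  · rw [pieceVert_odd, show 2 * m + 1 + 1 = 2 * m + 2 by ring, pieceVert_odd_succ] at hz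
    rw [pieceVert_even, pieceVert_odd] at hz'
    rcases eq_or_next_eq_of_mem_dart_conn hz' hz with h | h
    · exact ⟨m, m', Or.inl (by omega), Or.inl (by omega), h⟩
    · exact ⟨m + 1, m', Or.inr (by omega), Or.inl (by omega), h⟩
  · rw [pieceVert_odd, show 2 * m + 1 + 1 = 2 * m + 2 by ring, pieceVert_odd_succ] at hz
    rw [pieceVert_odd, show 2 * m' + 1 + 1 = 2 * m' + 2 by ring, pieceVert_odd_succ] at hz'
    rcases conn_conn_two_HT4 hz hz' with h | h
    · exact ⟨m, m', Or.inl (by omega), Or.inl (by omega), h.symm⟩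
    · exact ⟨m + 1, m' + 1, Or.inr (by omega), Or.inr (by omega), h.symm⟩

/-- **Pieces of orbit stretches of two configurations meet only at a common corner**
(registered anchor `ufrs_piecesMeet_two`; the cross-completion form of `ufrs_piecesMeet`):
corner-disjoint strands of DIFFERENT completed configurations have disjoint perturbed polylines. -/
theorem ufrs_piecesMeet_two : ∀ (β₁ β₂ : BondConfig (Site 2)) (q₁ q₂ : Site 2 × Fin 4) (j j' : ℕ) (z : ℂ), z ∈ segment ℝ (pieceVert β₁ q₁ j) (pieceVert β₁ q₁ (j + 1)) → z ∈ segment ℝ (pieceVert β₂ q₂ j') (pieceVert β₂ q₂ (j' + 1)) → ∃ s t : ℕ, (s = j / 2 ∨ s = (j + 1) / 2) ∧ (t = j' / 2 ∨ t = (j' + 1) / 2) ∧ cornerOrbit β₁ q₁ s = cornerOrbit β₂ q₂ t :=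
  fun _β₁ _β₂ q₁ q₂ _j _j' _z hz hz' => pieces_meet_two_HT4 q₁ q₂ hz hz'

/-! ## Pieces against followed edges and crossing segments of another configuration -/

/-- **A connector meets a lattice edge only if it is the vertex turn across that edge**, which is
then closed for its configuration (the content of `cyConn_disjoint_edgeTrace`, read off
`cyConn_cases`). -/
theorem conn_meets_edge_HT4 {β : BondConfig (Site 2)} (q : Site 2 × Fin 4) (m : ℕ) {u w : Site 2}
    (hadj : (zdGraph 2).Adj u w) {z : ℂ} (hz : z ∈ cyConn β q m) (hz' : z ∈ edgeTrace s(u, w)) :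
    cTgt (cornerOrbit β q m) = s(u, w) ∧ cTgt (cornerOrbit β q m) ∉ β := by
  rcases cyConn_cases m hz with ⟨I, J, hJI, hclosed, hv, hcol, -, hsrc, hshape⟩ | ⟨I, J, -, -, hshape⟩
  · obtain ⟨huj, hwj, hui⟩ := hshape.edge_eq hadj hz'
    rw [hcol] at hui
    have hc2 : IsCorner (cyV β q m) (cyF β q (m + 1)) := hv ▸ isCorner_cy (m + 1)
    have hedge : s(u, w) = cornerEdge (cyV β q m) (cyF β q (m + 1)) I :=
      IsMedialExploration.cornerEdge_eq_of_coords hc2 hJI huj hwj hui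
    have : cTgt (cornerOrbit β q m) = s(u, w) := by
      rw [hedge, ← hsrc, ← hv, ← cSrc_nextCorner]
      exact (cornerSource_faceAt _ _).symm
    exact ⟨this, hclosed⟩
  · exact absurd hz' (hshape.not_mem_edgeTrace hadj)

/-- **A piece of another configuration on a followed edge passes through the bounce.** If the
target edge of `p` is open in `β₁` and a piece of the orbit of `q` under `β₂` meets (the segment
of) that edge, then the orbit visits `p` or `nextCorner β₁ p` at the corresponding index. -/
theorem followedEdge_meets_piece_HT4 {β₁ β₂ : BondConfig (Site 2)} {p : Site 2 × Fin 4} (hp : cTgt p ∈ β₁)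
    (q : Site 2 × Fin 4) {j : ℕ} {z : ℂ} (hz : z ∈ segment ℝ (pieceVert β₂ q j) (pieceVert β₂ q (j + 1)))
    (hz' : z ∈ segment ℝ (Site.toComplex p.1) (Site.toComplex (p.1 + cornerUnit (p.2 + 1)))) :
    ∃ t, (t = j / 2 ∨ t = (j + 1) / 2) ∧ (cornerOrbit β₂ q t = p ∨ cornerOrbit β₂ q t = nextCorner β₁ p) := by
  have hadj : (zdGraph 2).Adj p.1 (p.1 + cornerUnit (p.2 + 1)) := (SimpleGraph.mem_edgeSet _).1 (cTgt_mem_edgeSet p)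
  have hzE : z ∈ edgeTrace s(p.1, p.1 + cornerUnit (p.2 + 1)) := by rw [edgeTrace_mk]; exact hz'
  obtain ⟨m, rfl | rfl⟩ := Nat.even_or_odd' j
  · rw [piece_even_eq_cyDart] at hz
    exact absurd hzE (cyDart_disjoint_edgeTrace m hadj hz)
  · rw [piece_odd_eq_cyConn] at hz
    obtain ⟨htgt, hclosed⟩ := conn_meets_edge_HT4 q m hadj hz hzE
    have htgt' : cTgt p = cTgt (cornerOrbit β₂ q m) := htgt.symm
    rcases eq_or_eq_opp_of_cTgt_eq htgt' with h | h
    · exact ⟨m, Or.inl (by omega), Or.inl h⟩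
    · refine ⟨m + 1, Or.inr (by omega), Or.inr ?_⟩
      show nextCorner β₂ (cornerOrbit β₂ q m) = nextCorner β₁ p
      rw [h] at hclosed ⊢
      exact nextCorner_opp_of_not_mem_HT4 hp hclosed

/-- **A piece of another configuration on a crossing segment passes through the crossing.** If
the target edge of `p` is closed in `β₁` and a piece of the orbit of `q` under `β₂` meets the
crossing segment of `p` (from the centre of its face to the centre of the next face around its
vertex), then the orbit visits `p` or `nextCorner β₁ p` at the corresponding index. -/
theorem crossSeg_meets_piece_HT4 {β₁ β₂ : BondConfig (Site 2)} {p : Site 2 × Fin 4} (hp : cTgt p ∉ β₁)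
    (q : Site 2 × Fin 4) {j : ℕ} {z : ℂ} (hz : z ∈ segment ℝ (pieceVert β₂ q j) (pieceVert β₂ q (j + 1)))
    (hz' : z ∈ segment ℝ (faceCenter (cFace p)) (faceCenter (faceAt p.1 (p.2 + 1)))) :
    ∃ t, (t = j / 2 ∨ t = (j + 1) / 2) ∧ (cornerOrbit β₂ q t = p ∨ cornerOrbit β₂ q t = nextCorner β₁ p) := by
  obtain ⟨m, rfl | rfl⟩ := Nat.even_or_odd' j
  · rw [pieceVert_even, pieceVert_odd] at hz
    exact (not_mem_dart_cross hz hz').elim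
  · rw [show 2 * m + 1 + 1 = 2 * m + 2 by ring, pieceVert_odd, pieceVert_odd_succ] at hz
    by_cases hc : cTgt (cornerOrbit β₂ q m) ∈ β₂
    · rw [nextCorner_of_mem hc] at hz
      have htgt : cTgt p = cTgt (cornerOrbit β₂ q m) := cTgt_eq_of_mem_fconn_cross hz hz'
      rcases eq_or_eq_opp_of_cTgt_eq htgt with h | h
      · exact ⟨m, Or.inl (by omega), Or.inl h⟩
      · refine ⟨m + 1, Or.inr (by omega), Or.inr ?_⟩
        show nextCorner β₂ (cornerOrbit β₂ q m) = nextCorner β₁ p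
        rw [h] at hc ⊢
        exact nextCorner_opp_of_mem_HT4 hp hc
    · rw [nextCorner_of_not_mem hc] at hz
      exact (not_mem_vconn_cross hz hz').elim

/-! ## Corner-disjoint stretches: the obstacle hypotheses, per step -/

/-- **Followed edges of a stretch miss the pieces of every corner-disjoint stretch of any
configuration.** If the stretch `[i₂, j₂]` of the orbit of `c₂` under `β₂` shares no corner with
the corners `O₁ c₁ t`, `O₁ c₁ (t+1)` of a stretch under `β₁` whose step `t` follows an open edge,
then no piece of the `β₂`-stretch meets that edge. -/
theorem followedEdge_not_mem_pieces_HT4 {β₁ β₂ : BondConfig (Site 2)} (c₁ c₂ : Site 2 × Fin 4) {t i₂ j₂ : ℕ}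
    (hopen : cTgt (cornerOrbit β₁ c₁ t) ∈ β₁)
    (hdis : ∀ s u, (s = t ∨ s = t + 1) → i₂ ≤ u → u ≤ j₂ → cornerOrbit β₁ c₁ s ≠ cornerOrbit β₂ c₂ u)
    {jj : ℕ} (hjj1 : 2 * i₂ ≤ jj) (hjj2 : jj + 1 ≤ 2 * j₂) {z : ℂ}
    (hz : z ∈ segment ℝ (pieceVert β₂ c₂ jj) (pieceVert β₂ c₂ (jj + 1))) :
    z ∉ segment ℝ (Site.toComplex (cornerOrbit β₁ c₁ t).1)
      (Site.toComplex ((cornerOrbit β₁ c₁ t).1 + cornerUnit ((cornerOrbit β₁ c₁ t).2 + 1))) := by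
  intro hz'
  obtain ⟨u, hu, h⟩ := followedEdge_meets_piece_HT4 hopen c₂ hz hz'
  have hu' : i₂ ≤ u ∧ u ≤ j₂ := by rcases hu with rfl | rfl <;> constructor <;> omega
  rcases h with h | h
  · exact hdis t u (Or.inl rfl) hu'.1 hu'.2 h.symm
  · exact hdis (t + 1) u (Or.inr rfl) hu'.1 hu'.2 h.symm

/-- **Crossing segments of a stretch miss the pieces of every corner-disjoint stretch of any
configuration** (same statement for a step `t` across a closed edge). -/
theorem crossSeg_not_mem_pieces_HT4 {β₁ β₂ : BondConfig (Site 2)} (c₁ c₂ : Site 2 × Fin 4) {t i₂ j₂ : ℕ}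
    (hclosed : cTgt (cornerOrbit β₁ c₁ t) ∉ β₁)
    (hdis : ∀ s u, (s = t ∨ s = t + 1) → i₂ ≤ u → u ≤ j₂ → cornerOrbit β₁ c₁ s ≠ cornerOrbit β₂ c₂ u)
    {jj : ℕ} (hjj1 : 2 * i₂ ≤ jj) (hjj2 : jj + 1 ≤ 2 * j₂) {z : ℂ}
    (hz : z ∈ segment ℝ (pieceVert β₂ c₂ jj) (pieceVert β₂ c₂ (jj + 1))) :
    z ∉ segment ℝ (faceCenter (cFace (cornerOrbit β₁ c₁ t))) (faceCenter (faceAt (cornerOrbit β₁ c₁ t).1 ((cornerOrbit β₁ c₁ t).2 + 1))) := by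
  intro hz'
  obtain ⟨u, hu, h⟩ := crossSeg_meets_piece_HT4 hclosed c₂ hz hz'
  have hu' : i₂ ≤ u ∧ u ≤ j₂ := by rcases hu with rfl | rfl <;> constructor <;> omega
  rcases h with h | h
  · exact hdis t u (Or.inl rfl) hu'.1 hu'.2 h.symm
  · exact hdis (t + 1) u (Or.inr rfl) hu'.1 hu'.2 h.symm

/-- **Pieces of corner-disjoint stretches of two configurations are disjoint.** -/
theorem pieces_disjoint_two_HT4 {β₁ β₂ : BondConfig (Site 2)} (c₁ c₂ : Site 2 × Fin 4) {i₁ j₁ i₂ j₂ : ℕ}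
    (hdis : ∀ s u, i₁ ≤ s → s ≤ j₁ → i₂ ≤ u → u ≤ j₂ → cornerOrbit β₁ c₁ s ≠ cornerOrbit β₂ c₂ u)
    {jj jj' : ℕ} (h1 : 2 * i₁ ≤ jj) (h2 : jj + 1 ≤ 2 * j₁) (h1' : 2 * i₂ ≤ jj') (h2' : jj' + 1 ≤ 2 * j₂) {z : ℂ}
    (hz : z ∈ segment ℝ (pieceVert β₁ c₁ jj) (pieceVert β₁ c₁ (jj + 1))) :
    z ∉ segment ℝ (pieceVert β₂ c₂ jj') (pieceVert β₂ c₂ (jj' + 1)) := by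
  intro hz'
  obtain ⟨s, u, hs, hu, h⟩ := pieces_meet_two_HT4 c₁ c₂ hz hz'
  have hs' : i₁ ≤ s ∧ s ≤ j₁ := by rcases hs with rfl | rfl <;> constructor <;> omega
  have hu' : i₂ ≤ u ∧ u ≤ j₂ := by rcases hu with rfl | rfl <;> constructor <;> omega
  exact hdis s u hs'.1 hs'.2 hu'.1 hu'.2 h

end

end Summit.CriticalPhenomena.CardyFormulaZ2.Cruxes.EdgePrecompact.QkzStripBoundaryArm
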